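import Literature.AlgebraicGeometry.Motives.ProjectiveSpaceHypersurfaceDegree
import Literature.AlgebraicGeometry.Motives.ProjectiveSpaceHypersurfaceCycle
import Literature.AlgebraicGeometry.Motives.SubschemeCyclesFundamentalProofs
import Mathlib.RingTheory.Polynomial.UniqueFactorization
import HarnessLib

/-!
# The fundamental class of a hypersurface `X ⊆ ℙ^{d+1}`: `i_*[X] = [V₊(F)] = e · [H]`, `deg X = e`

Fulton, *Intersection Theory* (2nd ed. 1998), §1.5 (the fundamental cycle `[X]` of a variety and
its push-forward along a closed immersion, `Z_k X' ⊆ Z_k X`), §2.1 (the Weil divisor of a Cartier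
divisor) and §2.5 / Examples 2.5.1–2.5.2, 1.9.3 (`deg V₊(F) = deg F`; `A_{n-1}(ℙⁿ) = ℤ · [H]`). For an
integral `K`-scheme `X` embedded by a closed immersion `i : X ↪ ℙ^{d+1}_K` onto the hypersurface
`V₊(F)` of a prime form `F` of degree `e` — the shape in which the tree states hypersurfaces
(`IsSmoothHypersurface`, `Literature/AlgebraicGeometry/SmoothProjective`; the cubic hypersurfaces of
`Motives/LinearSubspacesGenerateChow`) — this file identifies the push-forward of the fundamental
class with the divisor class of `F`:

* `Hypersurface.base_genericPoint_eq` — `i(η_X) = η_F`, the generic point of `V₊(F)`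
  (`ProjSpace.hypersurfacePoint`, `Motives/ProjectiveSpaceHypersurfaceCycle`); hence
  `Hypersurface.height_genericPoint` — **`dim X = d`**;
* `Hypersurface.map_primeCycle_genericPoint` — **`i_*[X] = [V₊(F)]`** as cycles on `ℙ^{d+1}`
  (`ProjSpace.cycle_formDivisor_eq_primeCycle_of_prime`);
* `Hypersurface.pushforward_fundamentalClass` — **`i_*[X] = e • [λ_d]` in `CH_d(ℙ^{d+1}_K)`**
  (`ProjSpace.chowClass_formDivisor_eq_smul`, `Motives/ProjectiveSpaceHypersurfaceDegree`);
* `Hypersurface.degree_fundamentalClass` — **`deg X = ∫ c₁(𝒪(1))ᵈ ∩ i_*[X] = e`** (`K`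
  algebraically closed; `ProjSpace.degreeEquiv`);
* `…_of_irreducible` variants in the binder shape of `IsSmoothHypersurface` /
  `Mboro2018_chowTwo_cubic` (`F.IsHomogeneous e`, `Irreducible F`; `K[x]` is factorial, so
  irreducible forms are prime — Mathlib's `Irreducible.prime`).

Everything is proved; no definitions, no named facts.

## References

* W. Fulton, *Intersection Theory*, 2nd ed., Springer (1998): §1.5 (p. 15), §2.1 (pp. 29–31), §2.5
  and Examples 2.5.1–2.5.2 (p. 41), Example 1.9.3 (p. 23). [Fulton1998]
-/

noncomputable section

universe u

open CategoryTheory AlgebraicGeometry Order Topology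
open Literature.AlgebraicGeometry.Motives.Segre Literature.AlgebraicGeometry.Motives.ProjSpace

attribute [local instance] MvPolynomial.gradedAlgebra

namespace Literature.AlgebraicGeometry.Motives

namespace Hypersurface

variable {K : Type u} [Field K] {d e : ℕ} {X : SchemeOver K} [IsIntegral X.left]
  [LocallyOfFiniteType X.hom] (i : X ⟶ projectiveSpace (d + 1) K) [IsClosedImmersion i.left]
  {F : MvPolynomial (Fin (d + 1 + 1)) K} (hF : F ∈ grading (Fin (d + 1 + 1)) K e) (hprime : Prime F)
  (hrange : Set.range i.left.base =
    ProjectiveSpectrum.zeroLocus (MvPolynomial.homogeneousSubmodule (Fin (d + 1 + 1)) K) {F})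

include hF hprime hrange

omit [LocallyOfFiniteType X.hom] in
/-- **`i(η_X) = η_F`**: a closed immersion onto `V₊(F)`, `F` prime, takes the generic point of `X`
to the generic point of the hypersurface (both are generic points of the irreducible closed set
`V₊(F)`). [cite: Fulton1998, §1.5 (p. 15)] -/
theorem base_genericPoint_eq :
    i.left.base (genericPoint ↥X.left) = hypersurfacePoint F hF hprime := by
  have h1 : IsGenericPoint (i.left.base (genericPoint ↥X.left)) (Set.range i.left.base) := by
    rw [isGenericPoint_def, ← Set.image_singleton, i.left.isClosedEmbedding.closure_image_eq,
      (genericPoint_spec ↥X.left).def, Set.image_univ]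
  have h2 : IsGenericPoint (hypersurfacePoint F hF hprime) (Set.range i.left.base) := by
    rw [isGenericPoint_def, hrange]
    exact closure_hypersurfacePoint F hF hprime
  exact h1.eq h2

omit [LocallyOfFiniteType X.hom] in
/-- **`dim X = d`** for a hypersurface `X ≅ V₊(F) ⊆ ℙ^{d+1}`. [cite: Fulton1998, Example 1.9.3 (p. 23)] -/
theorem height_genericPoint : height (genericPoint ↥X.left) = d := by
  rw [← height_base_eq_of_isClosedImmersion' i.left (genericPoint ↥X.left),
    base_genericPoint_eq i hF hprime hrange]
  exact height_hypersurfacePoint F hF hprime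

omit [LocallyOfFiniteType X.hom] in
/-- `dim X = d`, for the top element `⊤ = η_X` of the specialisation order. [folklore] -/
theorem height_top : height (⊤ : ↥X.left) = d :=
  height_genericPoint i hF hprime hrange

omit [LocallyOfFiniteType X.hom] in
/-- **`i_*[X] = [V₊(F)]`** as cycles on `ℙ^{d+1}`: the push-forward of the fundamental cycle of `X`
is the Weil divisor of `V₊(F)` (Fulton §1.5 with §2.1; multiplicity one since `F` is prime,
`ProjSpace.cycle_formDivisor_eq_primeCycle_of_prime`). [cite: Fulton1998, §1.5 (p. 15) and §2.1 (pp. 29–31)] -/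
theorem map_primeCycle_genericPoint :
    AlgebraicCycle.map i.left height height (primeCycle (genericPoint ↥X.left)) =
      (formDivisor F hF hprime.ne_zero).cycle := by
  rw [algebraicCycleMap_primeCycle, base_genericPoint_eq i hF hprime hrange,
    cycle_formDivisor_eq_primeCycle_of_prime]

/-- **`i_*[X] = e • [λ_d]` in `CH_d(ℙ^{d+1}_K)`**: the push-forward of the fundamental class of a
degree-`e` hypersurface is `e` times the class of a hyperplane (Fulton, Example 1.9.3 / §2.5:
`[V₊(F)] = e [H]`). [cite: Fulton1998, Example 1.9.3 (p. 23) and §2.5 (p. 41)] -/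
theorem pushforward_fundamentalClass :
    ChowGroup.pushforward d (map_mem_ratTrivial_holds d) i
        (ChowGroup.ofPoint (genericPoint ↥X.left) (height_genericPoint i hF hprime hrange)) =
      e • ChowGroup.ofPoint (X := (projectiveSpace (d + 1) K).left)
        (ProjectiveSpaceCells.coordGenericPoint K (n := d + 1) d)
        (ProjectiveSpaceCells.height_coordGenericPoint K (Nat.le_succ d)) := by
  rw [← chowClass_formDivisor_eq_smul hF hprime.ne_zero, CartierDivisor.chowClass_def,
    ChowGroup.ofPoint, ChowGroup.pushforward_mk]
  congr 1
  exact Subtype.ext (map_primeCycle_genericPoint i hF hprime hrange)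

/-- **The degree of a hypersurface is the degree of its equation: `deg X = ∫ c₁(𝒪(1))ᵈ ∩ i_*[X] = e`**
(`K` algebraically closed; Fulton, §2.5 and Example 2.5.2). [cite: Fulton1998, §2.5 and Example 2.5.2 (p. 41)] -/
theorem degree_fundamentalClass [IsAlgClosed K] :
    degreeEquiv (d + 1) (Nat.le_succ d) (ChowGroup.pushforward d (map_mem_ratTrivial_holds d) i
      (ChowGroup.ofPoint (genericPoint ↥X.left) (height_genericPoint i hF hprime hrange))) = e := by
  rw [pushforward_fundamentalClass i hF hprime hrange, map_nsmul,
    degreeEquiv_ofPoint (ProjectiveSpaceCells.isLinearSubspacePoint_coordGenericPoint K (Nat.le_succ d)),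
    nsmul_eq_mul, mul_one]


/-! ### The same with `IsHomogeneous` / `Irreducible` binders -/

omit hF hprime hrange

-- An irreducible polynomial over a field is prime (`K[x₀, …, x_N]` is factorial): this is Mathlib's
-- `Irreducible.prime` (via the `UniqueFactorizationMonoid` instance of `MvPolynomial`), used below.

omit [LocallyOfFiniteType X.hom] in
/-- **`dim X = d`** for `i : X ↪ ℙ^{d+1}` a closed immersion onto `V₊(F)`, `F` an irreducible form
(the binders of `IsSmoothHypersurface`). [cite: Fulton1998, Example 1.9.3 (p. 23)] -/
theorem height_genericPoint_of_irreducible {F : MvPolynomial (Fin (d + 1 + 1)) K}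
    (hF : F.IsHomogeneous e) (hirr : Irreducible F)
    (hrange : Set.range i.left.base =
      ProjectiveSpectrum.zeroLocus (MvPolynomial.homogeneousSubmodule (Fin (d + 1 + 1)) K) {F}) :
    height (genericPoint ↥X.left) = d :=
  height_genericPoint i ((MvPolynomial.mem_homogeneousSubmodule e F).2 hF) hirr.prime hrange

/-- **`i_*[X] = e • [λ_d]` in `CH_d(ℙ^{d+1}_K)`** for `i : X ↪ ℙ^{d+1}` a closed immersion onto the
hypersurface `V₊(F)` of an irreducible form `F` of degree `e` (the binders of `IsSmoothHypersurface`;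
e.g. `i_*[X] = 3 • [H]` for the cubic hypersurfaces of `Mboro2018_chowTwo_cubic`).
[cite: Fulton1998, Example 1.9.3 (p. 23) and §2.5 (p. 41)] -/
theorem pushforward_fundamentalClass_of_irreducible {F : MvPolynomial (Fin (d + 1 + 1)) K}
    (hF : F.IsHomogeneous e) (hirr : Irreducible F)
    (hrange : Set.range i.left.base =
      ProjectiveSpectrum.zeroLocus (MvPolynomial.homogeneousSubmodule (Fin (d + 1 + 1)) K) {F}) :
    ChowGroup.pushforward d (map_mem_ratTrivial_holds d) i
        (ChowGroup.ofPoint (genericPoint ↥X.left)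
          (height_genericPoint_of_irreducible i hF hirr hrange)) =
      e • ChowGroup.ofPoint (X := (projectiveSpace (d + 1) K).left)
        (ProjectiveSpaceCells.coordGenericPoint K (n := d + 1) d)
        (ProjectiveSpaceCells.height_coordGenericPoint K (Nat.le_succ d)) :=
  pushforward_fundamentalClass i ((MvPolynomial.mem_homogeneousSubmodule e F).2 hF) hirr.prime
    hrange

/-- **`deg X = e`** for `i : X ↪ ℙ^{d+1}` a closed immersion onto the hypersurface of an irreducible
form of degree `e`, `K` algebraically closed (e.g. `deg X = 3` for the cubic hypersurfaces of
`Mboro2018_chowTwo_cubic`). [cite: Fulton1998, §2.5 and Example 2.5.2 (p. 41)] -/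
theorem degree_fundamentalClass_of_irreducible [IsAlgClosed K] {F : MvPolynomial (Fin (d + 1 + 1)) K}
    (hF : F.IsHomogeneous e) (hirr : Irreducible F)
    (hrange : Set.range i.left.base =
      ProjectiveSpectrum.zeroLocus (MvPolynomial.homogeneousSubmodule (Fin (d + 1 + 1)) K) {F}) :
    degreeEquiv (d + 1) (Nat.le_succ d) (ChowGroup.pushforward d (map_mem_ratTrivial_holds d) i
      (ChowGroup.ofPoint (genericPoint ↥X.left)
        (height_genericPoint_of_irreducible i hF hirr hrange))) = e :=
  degree_fundamentalClass i ((MvPolynomial.mem_homogeneousSubmodule e F).2 hF) hirr.prime hrange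

end Hypersurface

end Literature.AlgebraicGeometry.Motives

end
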